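/-
Literature/NumberTheory/NumberFields/VanishingSumsRootsOfUnityTwoPowerOdd.lean — pub-hodgecm2 (COR-CM), KEPT Literature lane lit-deligne-3 gen 66,
file F66i.  THEOREMS ONLY (no `def`, no named fact, no `sorry`, no instance, no notation; D-0026 net debt 0).  HC_CM is NOT proved.
-/
import Literature.NumberTheory.NumberFields.VanishingSumsRootsOfUnityPrimePowers
import Literature.NumberTheory.NumberFields.CyclotomicGaussianIndependence
import HarnessLib

/-!
# Relations among roots of unity of order `2^{k+1}·m` (`m` odd): the `2^k` coordinates `Σ_{e<2^k} ω^e a_e = 0`, `a_e ∈ ℚ(ζ_m)`, force `a_e = 0`;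
# the mixed-difference criterion from every base point

Topic `Literature/NumberTheory/NumberFields` (namespace `Literature.NumberTheory.NumberFields.VanishingSumsTwoPowerOdd`); cell `pub-hodgecm2` (COR-CM), KEPT
Literature lane `lit-deligne-3` gen 66, file F66i — the arithmetic input of the lane's kernel decision at index `2^{k+1}·m` for an ARBITRARY `2`-part (the
cases `k = 0, 1` are the lane's F66c, F66d with `i ∉ ℚ(ζ_m)`).  KERNEL ONLY: theorems; no `def`, no named fact, no instance, no notation (D-0014 ∕ D-0026 net
debt `0`).  HC_CM is NOT proved here or anywhere in the lane.

## Mathematics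

Let `m` be odd, `ν` a primitive `m`-th and `ω` a primitive `2^{k+1}`-th root of unity.  Since `[ℚ(ζ_{2^{k+2}m}) : ℚ] = 2^{k+1}φ(m)` exceeds
`[ℚ(ν, ζ_{2^{k+1}}) : ℚ] ≤ φ(m)·2^k` ([Washington1997] Thm. 2.5, Prop. 2.4: `[ℚ(ζ_n):ℚ] = φ(n)`, `ℚ(ζ_a)ℚ(ζ_b) = ℚ(ζ_{ab})`), a primitive `2^{k+2}`-th root of
unity does NOT lie in `ℚ(ν, ζ_{2^{k+1}})` (**`notMem_sup_adjoin_of_two_pow`**).  By induction on `k` (split `e = 2e'`, `2e' + 1`: `Σ_e a_e ω^e = A + ωB` with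
`A, B ∈ ℚ(ν, ω²)`), a relation `Σ_{e<2^k} a_e ω^e = 0` with coefficients `a_e ∈ ℚ(ν)` is trivial (**`eq_zero_of_sum_mul_pow_eq_zero`** — the powers
`1, ω, …, ω^{2^k−1}` are linearly independent over `ℚ(ζ_m)`).  Combined with the lane's F66b (the Rédei ∕ de Bruijn ∕ Schoenberg criterion for `m = Πp_i^{a_i+1}` in
mixed-difference form, [LamLeung2000] Thm. 2.2): for rational `f_e : Πℤ/p_i^{a_i+1} → ℚ` (`e < 2^k`),

  `Σ_{e<2^k} ω^e Σ_x f_e(x) Πμ_i^{x_i} = 0 ⟺` every `f_e` has vanishing `k'`-th mixed differences along the admissible displacements (`p_i d_i = 0`)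

(**`sum_pow_mul_sum_eq_zero_iff_forall_alternatingSum`**) — the form consumed by the kernel decision at index `2^{k+1}m` (`ω = χ(σ^m)`, `f_e` the coset-count
differences from the base point `σ^{em}`).

PRESEARCH (lane rule): `[ℚ(ζ_n):ℚ] = φ(n)` and the compositum are [Washington1997] Ch. 2 (held book; tree `CyclotomicGaussian.finrank_adjoin_eq_totient`); the
relation theorem is [corpus: paper:arxiv-math_9511209 = LamLeung2000, chunk p0034, Thm. 2.2] (typed in F65d ∕ F66b); the `2`-power-coordinate form is
elementary Galois theory, not found verbatim (corpus hybrid «linearly independent roots of unity 2-power over cyclotomic field odd», galaxy «vanishing sums of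
roots of unity | linearly independent over Q(zeta)»: only the cited sources); recorded as the lane's own elementary lemma with those citations.

HONEST REGISTER.  Elementary; unconditional.  HC_CM is NOT proved and not used.

## References

* [Washington1997] L. C. Washington, *Introduction to Cyclotomic Fields*, 2nd ed., GTM 83, Ch. 2: Prop. 2.4, Thm. 2.5.
* [LamLeung2000] T. Y. Lam, K. H. Leung, *On vanishing sums of roots of unity*, J. Algebra 224 (2000), Thm. 2.2 (via the lane's F66b).
* [ConradK_CharSubgp] K. Conrad, *Characters of finite abelian groups* (via the tree's character files).

## Provenance

Cell `pub-hodgecm2` (COR-CM), KEPT Literature lane `lit-deligne-3` gen 66 (claim ROOTS-TWO-POWER-ODD; count-neutral, own lane), file F66i; neighbours cited by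
name, nothing restated: `CyclotomicGaussianIndependence` (`finrank_adjoin_eq_totient`), `VanishingSumsRootsOfUnityPrimePowers` (F66b: the criterion,
`isPrimitiveRoot_prod`, `mem_adjoin_prod`).  Theorems only; net Literature debt 0.
-/

noncomputable section

open scoped BigOperators Classical

namespace Literature.NumberTheory.NumberFields

namespace VanishingSumsTwoPowerOdd

open IntermediateField
open Literature.NumberTheory.NumberFields.CyclotomicGaussian (finrank_adjoin_eq_totient)
open Literature.NumberTheory.NumberFields.VanishingSumsPrimePowers
  (sum_mul_prod_pow_eq_zero_iff_forall_alternatingSum_eq_zero isPrimitiveRoot_prod mem_adjoin_prod)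

/-! ## §1 `ζ_{2^{k+2}} ∉ ℚ(ζ_m, ζ_{2^{k+1}})` for odd `m` -/

/-- **A primitive `2^{k+2}`-th root of unity does not lie in `ℚ(ν, ζ)`** for `ν` a primitive `m`-th root (`m` odd) and `ζ` a primitive `2^{k+1}`-th root:
else `ℚ(ων) = ℚ(ζ_{2^{k+2}m}) ⊆ ℚ(ν, ζ)` and `2^{k+1}φ(m) ≤ φ(m)·2^k`. [cite: Washington1997, Prop. 2.4 and Thm. 2.5] -/
theorem notMem_sup_adjoin_of_two_pow {m : ℕ} (hm : 0 < m) (h2m : ¬ 2 ∣ m) {ν : ℂ} (hν : IsPrimitiveRoot ν m) (k : ℕ) {ζ ω : ℂ}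
    (hζ : IsPrimitiveRoot ζ (2 ^ (k + 1))) (hω : IsPrimitiveRoot ω (2 ^ (k + 2))) : ω ∉ ℚ⟮ν⟯ ⊔ ℚ⟮ζ⟯ := by
  intro hmem
  have h2 : Nat.Coprime 2 m := (Nat.Prime.coprime_iff_not_dvd Nat.prime_two).2 h2m
  have hcop : Nat.Coprime (2 ^ (k + 2)) m := h2.pow_left _
  haveI : FiniteDimensional ℚ ℚ⟮ν⟯ := adjoin.finiteDimensional ((hν.isIntegral hm).tower_top)
  haveI : FiniteDimensional ℚ ℚ⟮ζ⟯ := adjoin.finiteDimensional ((hζ.isIntegral (by positivity)).tower_top)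
  -- `ω·ν` is a primitive `2^{k+2}m`-th root of unity inside `ℚ(ν, ζ)`
  have hη : IsPrimitiveRoot (ω * ν) (2 ^ (k + 2) * m) := by
    have h1 : orderOf ω = 2 ^ (k + 2) := hω.eq_orderOf.symm
    have h2' : orderOf ν = m := hν.eq_orderOf.symm
    rw [IsPrimitiveRoot.iff_orderOf, (Commute.all _ _).orderOf_mul_eq_mul_orderOf_of_coprime (by rw [h1, h2']; exact hcop), h1, h2']
  have hle : ℚ⟮ω * ν⟯ ≤ ℚ⟮ν⟯ ⊔ ℚ⟮ζ⟯ :=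
    adjoin_simple_le_iff.2 (mul_mem hmem ((le_sup_left : ℚ⟮ν⟯ ≤ ℚ⟮ν⟯ ⊔ ℚ⟮ζ⟯) (mem_adjoin_simple_self ℚ ν)))
  have hfin := finrank_le_of_le_right hle
  have hsup := finrank_sup_le ℚ⟮ν⟯ ℚ⟮ζ⟯
  rw [finrank_adjoin_eq_totient (Nat.mul_pos (by positivity) hm) hη, Nat.totient_mul hcop, Nat.totient_prime_pow_succ Nat.prime_two] at hfin
  rw [finrank_adjoin_eq_totient hm hν, finrank_adjoin_eq_totient (by positivity) hζ, Nat.totient_prime_pow_succ Nat.prime_two] at hsup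
  have h1 : 1 ≤ Nat.totient m := Nat.totient_pos.2 hm
  have h3 : 2 ^ (k + 1) * (2 - 1) * Nat.totient m ≤ Nat.totient m * (2 ^ k * (2 - 1)) := hfin.trans hsup
  have h4 : 2 ^ (k + 1) = 2 * 2 ^ k := by ring
  rw [h4] at h3
  have h5 : 0 < 2 ^ k := by positivity
  nlinarith

/-! ## §2 `1, ω, …, ω^{2^k−1}` are linearly independent over `ℚ(ζ_m)` (`m` odd, `ω` primitive of order `2^{k+1}`) -/

/-- `Σ_{e<2n} f(e) = Σ_{e'<n} (f(2e') + f(2e'+1))`. [folklore] -/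
private theorem sum_range_two_mul_tp (f : ℕ → ℂ) (n : ℕ) :
    ∑ e ∈ Finset.range (2 * n), f e = ∑ e ∈ Finset.range n, (f (2 * e) + f (2 * e + 1)) := by
  induction n with
  | zero => simp
  | succ n ih =>
    rw [show 2 * (n + 1) = 2 * n + 1 + 1 by ring, Finset.sum_range_succ, Finset.sum_range_succ, ih, Finset.sum_range_succ]
    ring

/-- **`Σ_{e<2^k} a_e ω^e = 0` with `a_e ∈ ℚ(ν)` forces `a_e = 0`** (`ν` primitive of odd order `m`, `ω` primitive of order `2^{k+1}`): induction on `k`,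
splitting even and odd `e` (`Σ = A + ωB`, `A, B ∈ ℚ(ν, ω²)`, `ω ∉ ℚ(ν, ω²)` by `notMem_sup_adjoin_of_two_pow`). [cite: Washington1997, Prop. 2.4 and Thm. 2.5] -/
theorem eq_zero_of_sum_mul_pow_eq_zero {m : ℕ} (hm : 0 < m) (h2m : ¬ 2 ∣ m) {ν : ℂ} (hν : IsPrimitiveRoot ν m) :
    ∀ (k : ℕ) {ω : ℂ}, IsPrimitiveRoot ω (2 ^ (k + 1)) → ∀ a : ℕ → ℂ, (∀ e < 2 ^ k, a e ∈ ℚ⟮ν⟯) →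
      ∑ e ∈ Finset.range (2 ^ k), a e * ω ^ e = 0 → ∀ e < 2 ^ k, a e = 0
  | 0, ω, _, a, _, h0, e, he => by
    rw [pow_zero, Finset.sum_range_one, pow_zero, mul_one] at h0
    have he0 : e = 0 := by simpa using he
    subst he0
    exact h0
  | k + 1, ω, hω, a, ha, h0, e, he => by
    have hpos : 0 < 2 ^ (k + 2) := by positivity
    have hζ : IsPrimitiveRoot (ω ^ 2) (2 ^ (k + 1)) := hω.pow hpos (by ring)
    -- split the relation into its even and odd parts: `A + ω B = 0`
    set A : ℂ := ∑ e ∈ Finset.range (2 ^ k), a (2 * e) * (ω ^ 2) ^ e with hA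
    set B : ℂ := ∑ e ∈ Finset.range (2 ^ k), a (2 * e + 1) * (ω ^ 2) ^ e with hB
    have hsplit : ∑ e ∈ Finset.range (2 ^ (k + 1)), a e * ω ^ e = A + ω * B := by
      rw [pow_succ, mul_comm (2 ^ k) 2, sum_range_two_mul_tp, Finset.sum_add_distrib, hA, hB, Finset.mul_sum]
      congr 1
      · exact Finset.sum_congr rfl fun e _ => by rw [← pow_mul]
      · exact Finset.sum_congr rfl fun e _ => by rw [← pow_mul, pow_succ, pow_mul]; ring
    rw [hsplit] at h0
    -- `A, B ∈ ℚ(ν, ω²)` and `ω ∉ ℚ(ν, ω²)`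
    have hmemL : ∀ c : ℕ → ℂ, (∀ e < 2 ^ k, c e ∈ ℚ⟮ν⟯) →
        ∑ e ∈ Finset.range (2 ^ k), c e * (ω ^ 2) ^ e ∈ ℚ⟮ν⟯ ⊔ ℚ⟮ω ^ 2⟯ := fun c hc =>
      sum_mem fun e he => mul_mem ((le_sup_left : ℚ⟮ν⟯ ≤ ℚ⟮ν⟯ ⊔ ℚ⟮ω ^ 2⟯) (hc e (Finset.mem_range.1 he)))
        ((le_sup_right : ℚ⟮ω ^ 2⟯ ≤ ℚ⟮ν⟯ ⊔ ℚ⟮ω ^ 2⟯) (pow_mem (mem_adjoin_simple_self ℚ (ω ^ 2)) _))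
    have haE : ∀ e < 2 ^ k, a (2 * e) ∈ ℚ⟮ν⟯ := fun e he => ha _ (by rw [pow_succ]; omega)
    have haO : ∀ e < 2 ^ k, a (2 * e + 1) ∈ ℚ⟮ν⟯ := fun e he => ha _ (by rw [pow_succ]; omega)
    have hAmem : A ∈ ℚ⟮ν⟯ ⊔ ℚ⟮ω ^ 2⟯ := hmemL (fun e => a (2 * e)) haE
    have hBmem : B ∈ ℚ⟮ν⟯ ⊔ ℚ⟮ω ^ 2⟯ := hmemL (fun e => a (2 * e + 1)) haO
    have hnot := notMem_sup_adjoin_of_two_pow hm h2m hν k hζ (by rw [show k + 2 = k + 1 + 1 by ring]; exact hω)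
    have hB0 : B = 0 := by
      by_contra hB0
      apply hnot
      have hωeq : ω = -A / B := by
        field_simp
        linear_combination h0
      convert div_mem (neg_mem hAmem) hBmem using 1
    have hA0 : A = 0 := by rwa [hB0, mul_zero, add_zero] at h0
    -- the induction hypothesis for `ω²` on both coordinates
    have ihE := eq_zero_of_sum_mul_pow_eq_zero hm h2m hν k hζ (fun e => a (2 * e)) haE hA0
    have ihO := eq_zero_of_sum_mul_pow_eq_zero hm h2m hν k hζ (fun e => a (2 * e + 1)) haO hB0
    obtain ⟨e', rfl | rfl⟩ := Nat.even_or_odd' e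
    · exact ihE e' (by rw [pow_succ] at he; omega)
    · exact ihO e' (by rw [pow_succ] at he; omega)

/-! ## §3 The mixed-difference criterion from every base point (`2`-part `2^{k+1}`, odd part `Πp_i^{a_i+1}`) -/

/-- **Relations of order `2^{k+1}·Πp_i^{a_i+1}` in base-point coordinates**: for `ω` primitive of order `2^{k+1}`, pairwise distinct ODD primes `p_i` (`k' ≥ 1` of
them), `μ_i` primitive of order `p_i^{a_i+1}` and rational `f_e` (`e < 2^k`), `Σ_{e<2^k} ω^e Σ_x f_e(x) Πμ_i^{x_i} = 0` iff EVERY `f_e` has vanishing `k'`-th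
mixed differences along the admissible displacements `d` (`p_i d_i = 0`) — the `2^k` coordinates over `ℚ(ζ_m)` (§2) and the lane's F66b criterion for each.
[cite: Washington1997, Prop. 2.4 and Thm. 2.5] [cite: LamLeung2000, Thm. 2.2] -/
theorem sum_pow_mul_sum_eq_zero_iff_forall_alternatingSum (k : ℕ) {ω : ℂ} (hω : IsPrimitiveRoot ω (2 ^ (k + 1))) {k' : ℕ} (hk' : 0 < k')
    {p a : Fin k' → ℕ} [∀ i, NeZero (p i ^ (a i + 1))] (hp : ∀ i, (p i).Prime) (hinj : Function.Injective p) (hodd : ∀ i, p i ≠ 2)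
    {μ : Fin k' → ℂ} (hμ : ∀ i, IsPrimitiveRoot (μ i) (p i ^ (a i + 1))) (f : Fin (2 ^ k) → (Π i, ZMod (p i ^ (a i + 1))) → ℚ) :
    ∑ e : Fin (2 ^ k), ω ^ (e : ℕ) * ∑ x : (Π i, ZMod (p i ^ (a i + 1))), algebraMap ℚ ℂ (f e x) * ∏ i, μ i ^ (x i).val = 0 ↔
      ∀ (e : Fin (2 ^ k)) (x d : Π i, ZMod (p i ^ (a i + 1))), (∀ i, p i • d i = 0) →
        ∑ ε : Fin k' → Bool, (∏ i, (if ε i then (-1 : ℚ) else 1)) * f e (fun i => if ε i then x i + d i else x i) = 0 := by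
  have hν := isPrimitiveRoot_prod k' p a μ hp hinj hμ
  have hm : 0 < ∏ i, p i ^ (a i + 1) := Finset.prod_pos fun i _ => pow_pos (hp i).pos _
  have h2m : ¬ 2 ∣ ∏ i, p i ^ (a i + 1) := by
    rw [← (Nat.Prime.coprime_iff_not_dvd Nat.prime_two)]
    exact Nat.Coprime.prod_right fun i _ => Nat.Coprime.pow_right _ ((Nat.coprime_primes Nat.prime_two (hp i)).2 (Ne.symm (hodd i)))
  have hmemμ : ∀ j, μ j ∈ ℚ⟮∏ i, μ i⟯ := mem_adjoin_prod k' p a μ hp hinj hμ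
  have hmem : ∀ e : Fin (2 ^ k),
      (∑ x : (Π i, ZMod (p i ^ (a i + 1))), algebraMap ℚ ℂ (f e x) * ∏ i, μ i ^ (x i).val) ∈ ℚ⟮∏ i, μ i⟯ := fun e =>
    sum_mem fun x _ => mul_mem (IntermediateField.algebraMap_mem _ _) (prod_mem fun i _ => pow_mem (hmemμ i) _)
  have _hk : 0 < k' := hk'
  constructor
  · intro h0 e
    -- the coordinates vanish
    set c : ℕ → ℂ := fun n => if hn : n < 2 ^ k then
      ∑ x : (Π i, ZMod (p i ^ (a i + 1))), algebraMap ℚ ℂ (f ⟨n, hn⟩ x) * ∏ i, μ i ^ (x i).val else 0 with hc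
    have hcmem : ∀ n < 2 ^ k, c n ∈ ℚ⟮∏ i, μ i⟯ := fun n hn => by
      rw [hc]; dsimp only; rw [dif_pos hn]; exact hmem ⟨n, hn⟩
    have hsum : ∑ n ∈ Finset.range (2 ^ k), c n * ω ^ n = 0 := by
      rw [← h0, ← Fin.sum_univ_eq_sum_range (fun n => c n * ω ^ n)]
      refine Finset.sum_congr rfl fun e _ => ?_
      rw [hc]; dsimp only; rw [dif_pos e.isLt, mul_comm]
    have hce := eq_zero_of_sum_mul_pow_eq_zero hm h2m hν k hω c hcmem hsum e e.isLt
    rw [hc] at hce; dsimp only at hce; rw [dif_pos e.isLt] at hce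
    exact (sum_mul_prod_pow_eq_zero_iff_forall_alternatingSum_eq_zero k' p a μ hp hinj hμ (f e)).1 hce
  · intro h
    refine Finset.sum_eq_zero fun e _ => ?_
    rw [(sum_mul_prod_pow_eq_zero_iff_forall_alternatingSum_eq_zero k' p a μ hp hinj hμ (f e)).2 (h e), mul_zero]

end VanishingSumsTwoPowerOdd

end Literature.NumberTheory.NumberFields

end
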